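import Mathlib.LinearAlgebra.Matrix.PosDef
import Literature.Analysis.FunctionSpaces.TorusFluidGlue
import HarnessLib

/-!
# Subsolutions of the incompressible Euler equations on the flat torus and Székelyhidi's
  localized convex-integration theorem (Székelyhidi 2011, Def. 1.2 and Thm. 1.3)

Topic `Analysis/FluidPDE`. This file vendors the convex-integration input of Székelyhidi's
vortex-sheet theorem (L. Székelyhidi Jr., *Weak solutions to the incompressible Euler equations
with vortex sheet initial data*, C. R. Math. Acad. Sci. Paris 349 (2011) 1063–1066; named fact
`Literature.Barriers.AnomalousDissipation.Szekelyhidi2011_thm11` in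
`Literature/Barriers/AnomalousDissipation/ShearFlowViscositySelectionWild.lean`):

* `Torus.IsEulerSubsolutionOn T e v u q` — **definition** (op. cit. Def. 1.2): a *subsolution
  with respect to the kinetic energy density `ē ≥ 0`* on `T^d × (0,T)` is a triple
  `(v̄, ū, q̄) : T^d × (0,T) → ℝ^d × S₀^{d×d} × ℝ`, `v̄ ∈ L²_loc`, `ū ∈ L¹_loc`, solving the linear
  system `∂ₜ v̄ + div ū + ∇ q̄ = 0`, `div v̄ = 0` in the sense of distributions on `T^d × (0,T)`
  ((3) op. cit.) and the relaxed constitutive inequality `v̄ ⊗ v̄ - ū ≤ (2/d) ē Id` a.e.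
  ((4) op. cit.). Here `S₀^{d×d}` are the symmetric trace-free matrices.
* `Torus.Szekelyhidi2011_thm13` — **named fact** (op. cit. Thm. 1.3 = De Lellis–Székelyhidi,
  Arch. Ration. Mech. Anal. 195 (2010), Prop. 2, "with an almost identical proof, except that in
  the proof one needs to perform the covering inside the region `U`"), two-dimensional case:
  if `(v̄, ū, q̄)` is a subsolution w.r.t. `ē` on `T² × (0,T)`, `U ⊆ T² × (0,T)` is open,
  `(v̄, ū, q̄)` and `ē` are continuous on `U` and `v̄ ⊗ v̄ - ū < ē Id` on `U`, then there is a
  perturbation `(ṽ, ũ) ∈ L^∞(T² × ℝ)`, `ṽ ∈ C(ℝ; L²_w(T²))`, solving `∂ₜ ṽ + div ũ = 0`,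
  `div ṽ = 0` in `𝒟'(T² × ℝ)`, vanishing off `U`, with
  `(v̄ + ṽ) ⊗ (v̄ + ṽ) - (ū + ũ) = ē Id` in `U` ((6) op. cit.).

## Formal rendering and its relation to the printed statements

Space–time fields are `ℝ → T^d → _` (time first, `T^d = UnitAddTorus d`, probability Haar
measure), as in the accepted `Literature/Analysis/FunctionSpaces/TorusFluidGlue`
(`Torus.IsWeakNSSolutionWithDataOn`); test fields are those of
`Literature/Analysis/FunctionSpaces/TorusTestFunction` (`Torus.IsSpaceTimeTestIoo T`: space–time
lift `C^∞`, compact time support inside `(0,T)`), `∂ₜ = Torus.timeDeriv`,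
`∂ⱼ φᵢ = Torus.fderiv (φ t) x eⱼ i`, `div = Torus.divergence`, `∇ = Torus.gradient`; the
distributional system (3) reads `∫₀ᵀ ∫ [v̄·∂ₜφ + ū : ∇φ + q̄ div φ] = 0` (`A : ∇φ = ∑ᵢⱼ Aᵢⱼ ∂ⱼφᵢ`)
for vector tests `φ` and `∫₀ᵀ ∫ v̄ · ∇ψ = 0` for scalar tests `ψ`.

* **Pressure.** Def. 1.2 allows the pressure `q̄` to be a distribution; we take `q̄ ∈ L¹_loc`
  (a restriction of the hypothesis class: every subsolution in our sense is one in the printed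
  sense). The stress `ū` is `Matrix d d ℝ`-valued with `ūᵀ = ū`, `tr ū = 0` pointwise.
* **Boundedness of `ē` on `U` (scope).** Thm. 1.3 concludes `(ṽ, ũ) ∈ L^∞_loc(T^n × ℝ)`; since
  (6) forces `½|v̄ + ṽ|² = ē` a.e. in `U`, this requires `ē` to be essentially bounded on `U`
  (for `ē ∈ L¹_loc` merely continuous on `U` and unbounded near `∂U` the printed conclusion
  fails). We therefore assume `ē` bounded on `U` explicitly — true in every application
  (op. cit. §2: `ē ≤ ½`; Bardos–Titi–Wiedemann 2012; De Lellis–Székelyhidi 2010, Prop. 2, where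
  `ē ∈ C(Ω̄ × ]0,T[)`).
* **Time slices (the one strengthening of the printed wording, taken from the cited source of
  the proof).** Thm. 1.3 prints (6) "a.e. in `U`"; its proof is that of De Lellis–Székelyhidi
  2010, Prop. 2, whose conclusion (iv) is "`½|v(x,t)|² = ē(x,t) 1_Ω` *for every* `t ∈ ]0,T[`,
  a.e. `x`" (the authors stress, §4: "we put a special emphasis on the fact that the equality in
  (iv) must hold for every time `t`"; the Baire-category space is a closed subspace of
  `C([0,T]; L²_w)` and the functionals are infima over time slices), and E. Wiedemann's thesis
  restates Thm. 1.3/1.4 with "energy density `ē`" meaning `½|v(x,t)|² = ē(x,t)` for every `t`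
  (Wiedemann 2012, Thm. 2.8, 2.18, 2.23). The every-time-slice form is exactly what Thm. 1.1 of
  Székelyhidi 2011 uses ("Infinitely many among these satisfy the energy equality, and
  infinitely many have strictly decreasing energy": `E(t) = ∫ ē(x,t) dx` for every `t`, op. cit.
  Remarks and (12)). We therefore render (6) and the vanishing of `ṽ` off `U` slice by slice:
  for every `t`, for a.e. `x`. (For `ũ`, which has no time continuity, "a.e. in space–time".)
* **"Infinitely many".** The printed conclusion gives infinitely many `(ṽ, ũ)`; we render the
  existence of one (which it implies). Infinitude of the weak solutions in applications is
  recovered by varying `ē` inside the strict region (see the proof of Thm. 1.1 from this fact in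
  `Literature/Barriers/AnomalousDissipation/ShearFlowViscositySelectionWild*.lean`).
* **Tests on `T² × ℝ`.** `(ṽ, ũ, 0)` solves (3) in `𝒟'(T² × ℝ)` and vanishes outside
  `U ⊆ (0,T) × T²`; equivalently (multiply a test field by a time cut-off equal to `1` on
  `[0,T]`) `∫₀ᵀ ∫ [ṽ·∂ₜφ + ũ : ∇φ] = 0` for *every* field `φ` with smooth space–time lift, with
  no support condition — the form recorded, which is the one consumed by
  `Torus.IsWeakNSSolutionWithDataOn` (tests on `[0,T)`). Weak incompressibility is recorded on
  every time slice (`Torus.IsWeaklyDivFree (ṽ t)`), which follows from `div ṽ = 0` in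
  `𝒟'(T² × ℝ)` and `ṽ ∈ C(ℝ; L²_w)`.

Not here: the proof (the De Lellis–Székelyhidi Baire-category argument in `C([0,T]; L²_w)` with
localized plane waves, op. cit. §4; an `XL` item), and Thm. 1.4 (the resulting criterion for
wild initial data), which for the vortex sheet is carried out directly in the barrier file.

## References

* L. Székelyhidi Jr., C. R. Math. Acad. Sci. Paris 349 (2011) 1063–1066, Def. 1.2, Thm. 1.3,
  Thm. 1.4, §2 (`Szekelyhidi2011`).
* C. De Lellis, L. Székelyhidi Jr., Arch. Ration. Mech. Anal. 195 (2010) 225–260, Prop. 2,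
  Lemma 3, §4 (`DeLellisSzekelyhidi2010`).
* E. Wiedemann, *Weak and measure-valued solutions of the incompressible Euler equations*,
  Dissertation, Bonn 2012, Thm. 2.8, Thm. 2.18, Thm. 2.22–2.23, §2.6 (`Wiedemann2012Thesis`).
* C. De Lellis, L. Székelyhidi Jr., Bull. Amer. Math. Soc. 49 (2012) 347–375, Thm. 2.4,
  Prop. 2.5, Thm. 3.4 (`DeLellisSzekelyhidi2012BAMS`).
-/

open MeasureTheory Set Filter Function
open scoped InnerProductSpace ContDiff
open Literature.Analysis.FunctionSpaces.Torus

noncomputable section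

namespace Literature.Analysis.FluidPDE

namespace Torus

/-! ## Subsolutions (Székelyhidi 2011, Def. 1.2) -/

section Subsolution

variable {d : Type*} [Fintype d] [DecidableEq d]

/-- **Subsolutions of incompressible Euler with respect to a kinetic energy density**
(Székelyhidi 2011, Def. 1.2; De Lellis–Székelyhidi 2010, §2 and Lemma 3.1): on `T^d × (0,T)`,
given `ē ≥ 0` in `L¹_loc`, a triple `(v̄, ū, q̄)` with `v̄ ∈ L²_loc`, `ū ∈ L¹_loc` symmetric and
trace-free, `q̄ ∈ L¹_loc` (the source allows `q̄ ∈ 𝒟'`), such that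
`∂ₜ v̄ + div ū + ∇ q̄ = 0` and `div v̄ = 0` in the sense of distributions on `T^d × (0,T)` —
`∫₀ᵀ∫ [v̄·∂ₜφ + ∑ᵢⱼ ūᵢⱼ ∂ⱼφᵢ + q̄ div φ] = 0` for every `ℝ^d`-valued test field `φ` compactly
supported in `(0,T)` and `∫₀ᵀ∫ v̄·∇ψ = 0` for every scalar one — and
`v̄ ⊗ v̄ - ū ≤ (2/d) ē Id` a.e. (positive semidefiniteness of the difference). Measurability and
local integrability refer to the product of Lebesgue measure on `(0,T)` and the Haar probability
measure of `T^d`; "locally" = on every `[a,b] × T^d`, `0 < a ≤ b < T`.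
[cite: Szekelyhidi2011, Def. 1.2] -/
structure IsEulerSubsolutionOn (T : ℝ) (e : ℝ → UnitAddTorus d → ℝ)
    (v : ℝ → UnitAddTorus d → EuclideanSpace ℝ d) (u : ℝ → UnitAddTorus d → Matrix d d ℝ)
    (q : ℝ → UnitAddTorus d → ℝ) : Prop where
  /-- `ē` is measurable on `(0,T) × T^d`. -/
  aestronglyMeasurable_energy : AEStronglyMeasurable (uncurry e) (volume.restrict (Ioo 0 T ×ˢ univ))
  /-- `v̄` is measurable on `(0,T) × T^d`. -/
  aestronglyMeasurable_velocity :
    AEStronglyMeasurable (uncurry v) (volume.restrict (Ioo 0 T ×ˢ univ))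
  /-- `ū` is measurable on `(0,T) × T^d` (entrywise). -/
  aestronglyMeasurable_stress : ∀ i j,
    AEStronglyMeasurable (fun p : ℝ × UnitAddTorus d => u p.1 p.2 i j)
      (volume.restrict (Ioo 0 T ×ˢ univ))
  /-- `q̄` is measurable on `(0,T) × T^d`. -/
  aestronglyMeasurable_pressure :
    AEStronglyMeasurable (uncurry q) (volume.restrict (Ioo 0 T ×ˢ univ))
  /-- `ē ≥ 0` a.e. -/
  energy_nonneg : ∀ᵐ p : ℝ × UnitAddTorus d ∂(volume.restrict (Ioo 0 T ×ˢ univ)), 0 ≤ e p.1 p.2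
  /-- `ē ∈ L¹_loc(T^d × (0,T))`. -/
  locallyIntegrable_energy : ∀ a b : ℝ, 0 < a → b < T →
    IntegrableOn (uncurry e) (Icc a b ×ˢ univ) volume
  /-- `v̄ ∈ L²_loc(T^d × (0,T))`. -/
  locallyIntegrable_velocity_sq : ∀ a b : ℝ, 0 < a → b < T →
    IntegrableOn (fun p : ℝ × UnitAddTorus d => ‖v p.1 p.2‖ ^ 2) (Icc a b ×ˢ univ) volume
  /-- `ū ∈ L¹_loc(T^d × (0,T))` (entrywise). -/
  locallyIntegrable_stress : ∀ i j, ∀ a b : ℝ, 0 < a → b < T →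
    IntegrableOn (fun p : ℝ × UnitAddTorus d => u p.1 p.2 i j) (Icc a b ×ˢ univ) volume
  /-- `q̄ ∈ L¹_loc(T^d × (0,T))`. -/
  locallyIntegrable_pressure : ∀ a b : ℝ, 0 < a → b < T →
    IntegrableOn (uncurry q) (Icc a b ×ˢ univ) volume
  /-- `ū` takes symmetric values (pointwise: representatives can always be so chosen). -/
  stress_symm : ∀ t x, (u t x).IsSymm
  /-- `ū` takes trace-free values (pointwise). -/
  stress_trace : ∀ t x, (u t x).trace = 0
  /-- `∂ₜ v̄ + div ū + ∇ q̄ = 0` in `𝒟'(T^d × (0,T))`: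
  `∫₀ᵀ∫ [v̄·∂ₜφ + ∑ᵢⱼ ūᵢⱼ ∂ⱼφᵢ + q̄ div φ] = 0`. -/
  momentum : ∀ φ : ℝ → UnitAddTorus d → EuclideanSpace ℝ d, IsSpaceTimeTestIoo T φ →
    ∫ t in Ioo 0 T, ∫ x, (⟪v t x, timeDeriv φ t x⟫_ℝ +
      ∑ i, ∑ j, u t x i j * FunctionSpaces.Torus.fderiv (φ t) x (EuclideanSpace.single j 1) i +
      q t x * divergence (φ t) x) = 0
  /-- `div v̄ = 0` in `𝒟'(T^d × (0,T))`: `∫₀ᵀ∫ v̄·∇ψ = 0`. -/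
  divFree : ∀ ψ : ℝ → UnitAddTorus d → ℝ, IsSpaceTimeTestIoo T ψ →
    ∫ t in Ioo 0 T, ∫ x, ⟪v t x, gradient (ψ t) x⟫_ℝ = 0
  /-- `v̄ ⊗ v̄ - ū ≤ (2/d) ē Id` a.e. on `(0,T) × T^d`. -/
  relaxed : ∀ᵐ p : ℝ × UnitAddTorus d ∂(volume.restrict (Ioo 0 T ×ˢ univ)),
    ((2 / (Fintype.card d : ℝ) * e p.1 p.2) • (1 : Matrix d d ℝ) -
      (Matrix.vecMulVec (v p.1 p.2) (v p.1 p.2) - u p.1 p.2)).PosSemidef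

end Subsolution

/-! ## Székelyhidi's localized convex-integration theorem (named fact, `n = 2`) -/

/-- The flat two-torus (local notation). -/
local notation "𝕋²" => UnitAddTorus (Fin 2)
/-- `ℝ²` (local notation). -/
local notation "E²" => EuclideanSpace ℝ (Fin 2)

/-- **Székelyhidi's localized subsolution theorem, two-dimensional case, every-time-slice form**
(Székelyhidi, C. R. Math. 349 (2011), Thm. 1.3: "Let `(v̄, ū, q̄)` be a subsolution with respect
to `ē` on `Tⁿ × (0,T)`. Assume that `U ⊂ Tⁿ × (0,T)` is an open subset such that `(v̄, ū, q̄)`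
and `ē` are continuous on `U` and `v̄ ⊗ v̄ - ū < (2/n) ē I` on `U`. Then there exist infinitely
many `(ṽ, ũ) ∈ L^∞_loc(Tⁿ × ℝ)` with `ṽ ∈ C(ℝ; L²_weak(Tⁿ))` such that `(ṽ, ũ, 0)` satisfies (3),
`(ṽ, ũ) = 0` a.e. in `Uᶜ`, and `(v̄ + ṽ) ⊗ (v̄ + ṽ) - (ū + ũ) = (2/n) ē I` a.e. in `U`"; proof =
De Lellis–Székelyhidi, ARMA 195 (2010), Prop. 2, whose conclusion (iv) holds *for every* `t`,
a.e. `x`). Rendering, `n = 2` (so `(2/n) ē = ē`), with `ē` assumed bounded on `U` (needed for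
the printed `L^∞` conclusion, see the module docstring) and the conclusion for one perturbation
(`(ṽ, ũ)`): `ṽ`, `ũ` are measurable on `ℝ × T²` and essentially bounded, `ũ` is symmetric
trace-free, `ṽ(t) ∈ L²` for every `t` and `t ↦ ∫ ⟪ṽ(t), w⟫` is continuous on `ℝ` for every
`w ∈ L²(T²)` (`ṽ ∈ C(ℝ; L²_w)`), `∫₀ᵀ∫ [ṽ·∂ₜφ + ∑ᵢⱼ ũᵢⱼ ∂ⱼφᵢ] = 0` for every field `φ` with smooth
space–time lift (≡ `∂ₜṽ + div ũ = 0` in `𝒟'(T² × ℝ)` given the vanishing off `U ⊆ (0,T) × T²`),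
`ṽ(t)` is weakly divergence free for every `t`, `(ṽ, ũ) = 0` a.e. off `U` and (6)
`(v̄ + ṽ) ⊗ (v̄ + ṽ) - (ū + ũ) = ē Id` a.e. in `U` (as printed), and moreover slice by slice:
for every `t`, for a.e. `x`, `ṽ(t,x) = 0` if `(t,x) ∉ U` and (6) holds at `(t,x)` if
`(t,x) ∈ U`. The time-slice form of (6) is the one strengthening of the printed
wording, taken from the cited proof (DLSz 2010, Prop. 2 (iv); Wiedemann 2012, Thm. 2.23); it is
what Thm. 1.1 of the paper uses. Not proved here (`XL`: Baire category in `C([0,T]; L²_w)`,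
localized plane waves).
[cite: Szekelyhidi2011, Thm. 1.3] [cite: DeLellisSzekelyhidi2010, Prop. 2] -/
def Szekelyhidi2011_thm13 : Prop :=
  ∀ (T : ℝ) (e : ℝ → 𝕋² → ℝ) (v : ℝ → 𝕋² → E²) (u : ℝ → 𝕋² → Matrix (Fin 2) (Fin 2) ℝ)
    (q : ℝ → 𝕋² → ℝ) (U : Set (ℝ × 𝕋²)),
    IsEulerSubsolutionOn T e v u q →
    IsOpen U → U ⊆ Ioo 0 T ×ˢ univ →
    ContinuousOn (uncurry e) U → ContinuousOn (uncurry v) U →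
    (∀ i j, ContinuousOn (fun p : ℝ × 𝕋² => u p.1 p.2 i j) U) → ContinuousOn (uncurry q) U →
    (∃ M : ℝ, ∀ p ∈ U, e p.1 p.2 ≤ M) →
    (∀ p ∈ U, ((e p.1 p.2) • (1 : Matrix (Fin 2) (Fin 2) ℝ) -
      (Matrix.vecMulVec (v p.1 p.2) (v p.1 p.2) - u p.1 p.2)).PosDef) →
    ∃ (w : ℝ → 𝕋² → E²) (z : ℝ → 𝕋² → Matrix (Fin 2) (Fin 2) ℝ),
      -- `(ṽ, ũ) ∈ L^∞(T² × ℝ)`: jointly measurable and essentially bounded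
      AEStronglyMeasurable (uncurry w) volume ∧
      (∀ i j, AEStronglyMeasurable (fun p : ℝ × 𝕋² => z p.1 p.2 i j) volume) ∧
      (∃ C : ℝ, (∀ t, ∀ᵐ x ∂volume, ‖w t x‖ ≤ C) ∧
        ∀ i j, ∀ᵐ p : ℝ × 𝕋² ∂volume, |z p.1 p.2 i j| ≤ C) ∧
      -- `ũ` takes values in the symmetric trace-free matrices
      (∀ t x, (z t x).IsSymm ∧ (z t x).trace = 0) ∧
      -- `ṽ ∈ C(ℝ; L²_w(T²))`
      (∀ t, MemLp (w t) 2 volume) ∧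
      (∀ g : 𝕋² → E², MemLp g 2 volume → Continuous fun t => ∫ x, ⟪w t x, g x⟫_ℝ) ∧
      -- `∂ₜ ṽ + div ũ = 0` (pressure `0`) and `div ṽ = 0` in `𝒟'(T² × ℝ)`
      (∀ φ : ℝ → 𝕋² → E², ContDiff ℝ ∞ (stLift φ) →
        ∫ t in Ioo 0 T, ∫ x, (⟪w t x, timeDeriv φ t x⟫_ℝ +
          ∑ i, ∑ j, z t x i j *
            FunctionSpaces.Torus.fderiv (φ t) x (EuclideanSpace.single j 1) i) = 0) ∧
      (∀ t, IsWeaklyDivFree (w t)) ∧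
      -- `(ṽ, ũ) = 0` a.e. off `U` (as printed), and on every time slice for `ṽ`
      (∀ᵐ p : ℝ × 𝕋² ∂volume, p ∉ U → w p.1 p.2 = 0 ∧ z p.1 p.2 = 0) ∧
      (∀ t, ∀ᵐ x ∂volume, (t, x) ∉ U → w t x = 0) ∧
      -- (6): `(v̄ + ṽ) ⊗ (v̄ + ṽ) - (ū + ũ) = ē Id` a.e. in `U` (as printed), and on every
      -- time slice of `U`
      (∀ᵐ p : ℝ × 𝕋² ∂volume, p ∈ U →
        Matrix.vecMulVec (v p.1 p.2 + w p.1 p.2) (v p.1 p.2 + w p.1 p.2) -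
          (u p.1 p.2 + z p.1 p.2) = (e p.1 p.2) • (1 : Matrix (Fin 2) (Fin 2) ℝ)) ∧
      (∀ t, ∀ᵐ x ∂volume, (t, x) ∈ U →
        Matrix.vecMulVec (v t x + w t x) (v t x + w t x) - (u t x + z t x) =
          (e t x) • (1 : Matrix (Fin 2) (Fin 2) ℝ))

/-! ## Elementary consequences of the definitions -/

section Consequences

variable {d : Type*} [Fintype d] [DecidableEq d]

omit [DecidableEq d] in
/-- The quadratic form of `v ⊗ v` is a square: `xᵀ (v ⊗ v) x = (v·x)²`. [folklore] -/
theorem dotProduct_vecMulVec_mulVec (v x : d → ℝ) :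
    x ⬝ᵥ (Matrix.vecMulVec v v).mulVec x = (v ⬝ᵥ x) ^ 2 := by
  rw [Matrix.dotProduct_mulVec, Matrix.vecMul_vecMulVec, smul_dotProduct, smul_eq_mul, sq,
    dotProduct_comm x v]

/-- **Subsolutions have kinetic energy at most `ē`** (Székelyhidi 2011, after Def. 1.2:
"subsolutions automatically satisfy `½|v̄|² ≤ ē` a.e."; here the pointwise statement): if
`(2/d) ē Id - (v̄ ⊗ v̄ - ū)` is positive semidefinite with `ū` trace-free, then `|v̄|² ≤ 2 ē`
(take the trace: `tr (v̄ ⊗ v̄) = |v̄|²`, `tr ū = 0`, `tr Id = d`).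
[cite: Szekelyhidi2011, Def. 1.2 and the remark following it] -/
theorem norm_sq_le_two_mul_of_posSemidef [Nonempty d] {e : ℝ} {v : EuclideanSpace ℝ d}
    {u : Matrix d d ℝ} (htr : u.trace = 0)
    (h : ((2 / (Fintype.card d : ℝ) * e) • (1 : Matrix d d ℝ) -
      (Matrix.vecMulVec v v - u)).PosSemidef) :
    ‖v‖ ^ 2 ≤ 2 * e := by
  have hcard : (0 : ℝ) < Fintype.card d := by exact_mod_cast Fintype.card_pos
  -- the trace of a positive semidefinite matrix is nonnegative
  have htrace := h.trace_nonneg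
  rw [Matrix.trace_sub, Matrix.trace_sub, Matrix.trace_smul, Matrix.trace_one, htr, sub_zero,
    Matrix.trace_vecMulVec, smul_eq_mul] at htrace
  have hvv : (v : d → ℝ) ⬝ᵥ (v : d → ℝ) = ‖v‖ ^ 2 := by
    rw [EuclideanSpace.norm_sq_eq, dotProduct]
    refine Finset.sum_congr rfl fun i _ => ?_
    rw [Real.norm_eq_abs, sq_abs, sq]
  rw [hvv] at htrace
  have : 2 / (Fintype.card d : ℝ) * e * Fintype.card d = 2 * e := by
    field_simp
  linarith

end Consequences

end Torus

end Literature.Analysis.FluidPDE
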